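import Mathlib
import Summits.Ventures.PercRepro2.SwOutSevDefs
import Summits.Ventures.PercRepro2.SwOutSevPieces

/-!
# The data of a core-kind point: first lemmas (blind cell PercRepro2, night-4 g22, 2026-08-27;
proofs/NIGHT4-G22.md §2)

The h-pieces and the pieces do not see the colours (`AhOfR_blue`, `pieceC_blue`); a piece of the
data is the piece of a vertex of the h-piece of a mixed arm (`exists_pieceC_of_mem_piecesR`,
`mem_piecesR_of_mem_AhOfR'`); every u-arm set of the data (a u-arm or an absorbed arm) and every
far arm is an arm (`dataU_mem_armsC`, `dataF_mem_armsC`), a piece lies in the h-piece of its arm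
(`dataAh_subset`), and every vertex of an arm set lies in the extended hull
(`mem_extHull_of_mem_armsAllR`).
-/

namespace Summit.Ventures.PercRepro2

namespace MixedArms

open Hull LocRows BigBlock

variable {V : Type*} {E : Type*} [Fintype E] [DecidableEq E]

open scoped Classical

variable {ends : E → Sym2 V} {ρ : Type*} [Fintype ρ] {U : Set V} {h o u : V} {p : ρ → V}

section Blue

variable {ζ : Config E} {r : ρ}

omit [Fintype E] [DecidableEq E] [Fintype ρ] in
/-- The h-piece does not see the colours. -/
lemma AhOfR_blue : AhOfR ends h u p (blue ζ) r = AhOfR ends h u p ζ r := by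
  simp only [AhOfR, armC_eq_of_extHull_eq extHull_blue]

omit [Fintype E] [DecidableEq E] [Fintype ρ] in
/-- The pieces do not see the colours. -/
lemma pieceC_blue (y : V) : pieceC ends h u p (blue ζ) r y = pieceC ends h u p ζ r y := by
  simp only [pieceC, AhOfR_blue]

omit [DecidableEq E] in
/-- A piece of the data is the piece of a vertex of the h-piece of a mixed arm. -/
lemma exists_pieceC_of_mem_piecesR {x : ρ × Set V} (hx : x ∈ piecesR ends h u p ζ) :
    DeadBlueR ends h u p ζ x.1 ∧ ∃ y ∈ AhOfR ends h u p ζ x.1, x.2 = pieceC ends h u p ζ x.1 y := by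
  obtain ⟨hd, e, he, hx⟩ := mem_piecesR_iff.1 hx
  obtain ⟨y, hey, hy⟩ := mem_deadEdgesR_iff.1 he
  exact ⟨hd, y, hy, by rw [hx, pieceOfEdgeR_eq hey hy]⟩

end Blue

section Base

omit [DecidableEq E] in
/-- A vertex of the h-piece of a mixed arm lies in a piece of the data. -/
lemma mem_piecesR_of_mem_AhOfR' {ζ : Config E} {r : ρ} (hd : DeadBlueR ends h u p ζ r) {x : V}
    (hx : x ∈ AhOfR ends h u p ζ r) :
    (r, pieceC ends h u p ζ r x) ∈ piecesR ends h u p ζ := by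
  obtain ⟨e, y, hey, hy, hxy⟩ := exists_dead_of_mem_AhOfR hx
  refine mem_piecesR_iff.2 ⟨hd, e, mem_deadEdgesR_iff.2 ⟨y, hey, hy⟩, ?_⟩
  rw [pieceOfEdgeR_eq hey hy, pieceC_eq_of_mem hxy]

section Data

variable {ζ : Config E}

omit [DecidableEq E] in
/-- A piece of the data lies in the h-piece of its (mixed) arm. -/
lemma dataAh_subset (i : (mixedDataR ends h u p ζ).ν) :
    (mixedDataR ends h u p ζ).Ah i ⊆ AhOfR ends h u p ζ i.1.1 := by
  obtain ⟨-, y, hy, hi⟩ := exists_pieceC_of_mem_piecesR (Finset.mem_filter.1 i.2).1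
  show i.1.2 ⊆ _
  rw [hi]; exact pieceC_subset hy

omit [DecidableEq E] in
/-- A far arm of the data is an arm. -/
lemma dataF_mem_armsC (k : (mixedDataR ends h u p ζ).κ) :
    (mixedDataR ends h u p ζ).F k ∈ armsC ends h u ζ := (mem_farArmsR_iff.1 k.2).1

end Data

variable (hj : MixedJunctionR ends U h u p o)
include hj

section Data

variable {ζ : Config E}

omit [DecidableEq E] in
/-- A u-arm set of the data (a u-arm or an absorbed arm) is an arm. -/
lemma dataU_mem_armsC (j : (mixedDataR ends h u p ζ).ι) :
    (mixedDataR ends h u p ζ).U j ∈ armsC ends h u ζ := by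
  rcases j with ⟨P, hP⟩ | ⟨x, hx⟩
  · exact (mem_uArmsR_iff.1 hP).1
  · obtain ⟨-, hx2⟩ := mem_absArmsR_iff.1 hx
    show x.2 ∈ armsC ends h u ζ
    rw [hx2]; exact armP_mem_armsC_R hj ζ x.1

omit [DecidableEq E] in
/-- Every vertex of an arm set of the data lies in the extended hull, and is neither `h` nor
`u`. -/
lemma mem_extHull_of_mem_armsAllR {x : V}
    (hx : x ∈ armsAllR (mixedDataR ends h u p ζ).U (mixedDataR ends h u p ζ).Ah
      (mixedDataR ends h u p ζ).F) :
    x ∈ extHull ends ζ h u ∧ x ≠ h ∧ x ≠ u := by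
  rcases hx with (hx | hx) | hx
  · obtain ⟨j, hj'⟩ := Set.mem_iUnion.1 hx
    exact armsC_subset (dataU_mem_armsC hj j) x hj'
  · obtain ⟨i, hi⟩ := Set.mem_iUnion.1 hx
    exact armsC_subset (armP_mem_armsC_R hj ζ i.1.1) x (dataAh_subset i hi).1
  · obtain ⟨k, hk⟩ := Set.mem_iUnion.1 hx
    exact armsC_subset (dataF_mem_armsC k) x hk

end Data

end Base

end MixedArms

end Summit.Ventures.PercRepro2
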